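import Summits.HubbardSuperconductivity.HubbardSuperconductivity.Theorems.AnisotropyChordTransferFibre3B1Bracket

/-!
# Route `AnisotropyChord` / H0 rotor rung, LEVEL 2 family B1: MONOTONICITY IN `ν` and the ν-CELL form of the generic bracket

LEVEL2-SPEC §6 item 5 assembles «Level2Margin(L₀) > 0 ∀ L ≥ L₀, ∀ ν-cell» as a finite table of L-uniform enclosures on
a ν-grid with MONOTONE pieces per cell.  For the family-B1 sums this file supplies the monotonicity: with `θ = 2π/L`,
`λ = νθ²`, every propagator `g = 1/(2ε − λ)` is increasing in `ν` below the spectrum (`ν < 4/π²`), hence so is every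
`torSum`; and the three L-independent pieces of `b1Bracket` — `loSum`, `hiSum`, `tailConst` — are increasing in `ν` too.
* `two_epsT_sub_pos`, `gres_mono`, `torSum_mono` (the torus side);
* `loSum_mono`, `hiSum_mono`, `tailConst_mono` (the bracket side);
* ★ `b1Bracket_cell`: for `0 ≤ ν₁ ≤ ν ≤ ν₂ < 4/π²`,
  `loSum ν₁ K S s a ≤ θ^{2n}·torSum L (νθ²) s a ≤ hiSum ν₂ θ₀ K S s a + tailConst ν₂ (K − 2S) n`
  — ONE pair of endpoint evaluations certifies a whole ν-cell, for every `L` with `2π/L ≤ θ₀`.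
Prover seat `hubbard-h0-rotor-p2` g4; helper for piece A = stmt-HubbardSuperconductivity-23918 of rung 19089
(`--supports`, helper class).  Nothing here proves superconductivity in the Hubbard model; helper lemmas of ONE conditional
reduction (the GM₃ ∀L certificate, Level-2 rows); the rotor TARGET as originally worded stays FALSE (g15 verdict).
Mathlib + the tree only; no sorry.
-/

set_option linter.dupNamespace false
set_option autoImplicit false

noncomputable section

open scoped BigOperators

namespace Summit.HubbardSuperconductivity.HubbardSuperconductivity.Theorems.AnisotropyChord.Transfer.Fibre3.B1

variable (L : ℕ) [NeZero L]

/-! ## The torus side -/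

/-- below the spectrum: `0 < 2ε(k) − νθ²` for `k ≠ 0`, `ν < 4/π²` (Jordan at the centred representative). [folklore] -/
theorem two_epsT_sub_pos (ν : ℝ) (hν : ν < 4 / Real.pi ^ 2) (k : Tor L) (hk : k ≠ 0) :
    0 < 2 * epsT L k - ν * (2 * Real.pi / L) ^ 2 := by
  have hj := RateLemma.jordanEpsLower_holds L k
  have hs := one_le_sq_add_sq _ _ (rep_ne_zero L hk)
  have hLpos : (0 : ℝ) < L := by exact_mod_cast Nat.pos_of_ne_zero (NeZero.ne L)
  have hθ2 : 0 < (2 * Real.pi / L) ^ 2 := by positivity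
  have h1 : 2 / Real.pi ^ 2 * (2 * Real.pi / L) ^ 2 * 1
      ≤ 2 / Real.pi ^ 2 * (2 * Real.pi / L) ^ 2
        * ((((k.1.valMinAbs : ℤ) : ℝ)) ^ 2 + (((k.2.valMinAbs : ℤ) : ℝ)) ^ 2) :=
    mul_le_mul_of_nonneg_left hs (by positivity)
  have h2 : ν * (2 * Real.pi / L) ^ 2 < 4 / Real.pi ^ 2 * (2 * Real.pi / L) ^ 2 :=
    mul_lt_mul_of_pos_right hν hθ2
  have h3 : 2 / Real.pi ^ 2 * (2 * Real.pi / L) ^ 2 * 1 ≤ epsT L k := h1.trans hj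
  have h4 : 4 / Real.pi ^ 2 * (2 * Real.pi / L) ^ 2 = 2 * (2 / Real.pi ^ 2 * (2 * Real.pi / L) ^ 2 * 1) := by
    ring
  linarith [h2, h3, h4]

/-- each propagator is increasing in `ν` below the spectrum. [folklore] -/
theorem gres_mono (ν ν' : ℝ) (hνν' : ν ≤ ν') (hν' : ν' < 4 / Real.pi ^ 2) (k : Tor L) :
    gres L (ν * (2 * Real.pi / L) ^ 2) k ≤ gres L (ν' * (2 * Real.pi / L) ^ 2) k := by
  unfold gres
  split_ifs with hk
  · exact le_rfl
  · have hpos := two_epsT_sub_pos L ν' hν' k hk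
    apply one_div_le_one_div_of_le hpos
    have : ν * (2 * Real.pi / L) ^ 2 ≤ ν' * (2 * Real.pi / L) ^ 2 :=
      mul_le_mul_of_nonneg_right hνν' (sq_nonneg _)
    linarith

variable {ι : Type*} [Fintype ι]

/-- every family-B1 torus sum is increasing in `ν` below the spectrum. [folklore] -/
theorem torSum_mono (ν ν' : ℝ) (hνν' : ν ≤ ν') (hν' : ν' < 4 / Real.pi ^ 2) (s : ι → ℤ × ℤ) (a : ι → ℕ) :
    torSum L (ν * (2 * Real.pi / L) ^ 2) s a ≤ torSum L (ν' * (2 * Real.pi / L) ^ 2) s a := by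
  unfold torSum
  apply Finset.sum_le_sum
  intro k _
  apply Finset.prod_le_prod
  · intro i _
    exact pow_nonneg (gres_nonneg L ν (lt_of_le_of_lt hνν' hν') _) _
  · intro i _
    exact pow_le_pow_left₀ (gres_nonneg L ν (lt_of_le_of_lt hνν' hν') _) (gres_mono L ν ν' hνν' hν' _) _

/-! ## The bracket side -/

omit [NeZero L] in
/-- the lower window sum is increasing in `ν`. [folklore] -/
theorem loSum_mono (ν ν' : ℝ) (hνν' : ν ≤ ν') (hν' : ν' < 4 / Real.pi ^ 2) (K S : ℕ) (s : ι → ℤ × ℤ)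
    (a : ι → ℕ) : loSum ν K S s a ≤ loSum ν' K S s a := by
  unfold loSum
  apply Finset.sum_le_sum
  intro p hp
  rw [mem_idx_iff] at hp
  have hν : ν < 4 / Real.pi ^ 2 := lt_of_le_of_lt hνν' hν'
  apply Finset.prod_le_prod
  · intro i _
    exact pow_nonneg (lo_nonneg ν hν _ ((mem_zWindow_iff K _).1 (hp.2 i)).1) _
  · intro i _
    have hq0 := ((mem_zWindow_iff K _).1 (hp.2 i)).1
    apply pow_le_pow_left₀ (lo_nonneg ν hν _ hq0)
    have h1 : (1 : ℝ) ≤ nsq (p + s i) := one_le_sq_add_sq _ _ hq0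
    have hpi3 := Real.pi_gt_three
    have h2 : ν' < 1 := lt_of_lt_of_le hν' (by rw [div_le_one (by positivity)]; nlinarith)
    exact one_div_le_one_div_of_le (by linarith) (by linarith)

/-- the upper window sum is increasing in `ν`. [folklore] -/
theorem hiSum_mono (ν ν' : ℝ) (hνν' : ν ≤ ν') (hν' : ν' < 4 / Real.pi ^ 2) (θ0 : ℝ) (K S : ℕ)
    (hθ0 : 2 * Real.pi / L ≤ θ0) (hθ0K : θ0 * K ≤ Real.pi / 2) (s : ι → ℤ × ℤ) (a : ι → ℕ) :
    hiSum ν θ0 K S s a ≤ hiSum ν' θ0 K S s a := by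
  unfold hiSum
  apply Finset.sum_le_sum
  intro p hp
  rw [mem_idx_iff] at hp
  have hν : ν < 4 / Real.pi ^ 2 := lt_of_le_of_lt hνν' hν'
  apply Finset.prod_le_prod
  · intro i _
    exact pow_nonneg (div_nonneg zero_le_one (hi_den_pos L ν hν θ0 K hθ0 hθ0K _ (hp.2 i)).le) _
  · intro i _
    apply pow_le_pow_left₀ (div_nonneg zero_le_one (hi_den_pos L ν hν θ0 K hθ0 hθ0K _ (hp.2 i)).le)
    exact one_div_le_one_div_of_le (hi_den_pos L ν' hν' θ0 K hθ0 hθ0K _ (hp.2 i)) (by linarith)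

omit [NeZero L] in
/-- the tail constant is increasing in `ν` (`K' ≥ 2`). [folklore] -/
theorem tailConst_mono (ν ν' : ℝ) (hν0 : 0 ≤ ν) (hνν' : ν ≤ ν') (hν' : ν' < 4 / Real.pi ^ 2) (K' n : ℕ)
    (hK' : 2 ≤ K') : tailConst ν K' n ≤ tailConst ν' K' n := by
  unfold tailConst
  have hpi := Real.pi_pos
  have hpi3 := Real.pi_gt_three
  have hK'R : (2 : ℝ) ≤ K' := by exact_mod_cast hK'
  have hc1 : ν' * Real.pi ^ 2 / 4 < 1 := by
    rw [div_lt_one (by norm_num)]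
    have := (lt_div_iff₀ (by positivity)).mp hν'
    linarith
  have hcc : ν * Real.pi ^ 2 / 4 ≤ ν' * Real.pi ^ 2 / 4 := by
    apply div_le_div_of_nonneg_right _ (by norm_num)
    exact mul_le_mul_of_nonneg_right hνν' (by positivity)
  have hc0 : 0 ≤ ν * Real.pi ^ 2 / 4 := by positivity
  have hD1' : 0 < ((K' : ℝ) + 1) ^ 2 - ν' * Real.pi ^ 2 / 4 := by nlinarith
  have hD2' : 0 < (K' : ℝ) ^ 2 - ν' * Real.pi ^ 2 / 4 := by nlinarith
  apply div_le_div_of_nonneg_left (by positivity) (mul_pos (pow_pos hD1' _) hD2')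
  apply mul_le_mul _ (by linarith) hD2'.le (pow_nonneg (by linarith) _)
  exact pow_le_pow_left₀ hD1'.le (by linarith) _

/-! ## The ν-cell form -/

/-- **THE B1 BRACKET ON A ν-CELL**: for `0 ≤ ν₁ ≤ ν ≤ ν₂ < 4/π²` (and the hypotheses of `b1Bracket`),
`loSum ν₁ ≤ θ^{2n}·torSum L (νθ²) ≤ hiSum ν₂ + tailConst ν₂ (K − 2S) n` — endpoint evaluations certify the cell. -/
theorem b1Bracket_cell (θ0 : ℝ) (K S : ℕ) (s : ι → ℤ × ℤ) (a : ι → ℕ) (n : ℕ)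
    (ha : ∀ i, 1 ≤ a i) (hn : ∑ i, a i = n) (h2 : 2 ≤ n)
    (hS : ∀ i, (s i).1.natAbs ≤ S ∧ (s i).2.natAbs ≤ S) (hK : 2 + 2 * S ≤ K)
    (hθ0 : 2 * Real.pi / L ≤ θ0) (hθ0K : θ0 * K ≤ Real.pi / 2)
    (ν₁ ν ν₂ : ℝ) (hν₁ : 0 ≤ ν₁) (h1 : ν₁ ≤ ν) (h2' : ν ≤ ν₂) (hν₂ : ν₂ < 4 / Real.pi ^ 2) :
    loSum ν₁ K S s a ≤ (2 * Real.pi / L) ^ (2 * n) * torSum L (ν * (2 * Real.pi / L) ^ 2) s a ∧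
      (2 * Real.pi / L) ^ (2 * n) * torSum L (ν * (2 * Real.pi / L) ^ 2) s a
        ≤ hiSum ν₂ θ0 K S s a + tailConst ν₂ (K - 2 * S) n := by
  have hν : ν < 4 / Real.pi ^ 2 := lt_of_le_of_lt h2' hν₂
  have hν0 : 0 ≤ ν := hν₁.trans h1
  obtain ⟨hlo, hhi⟩ := b1Bracket L θ0 K S s a n ha hn h2 hS hK hθ0 hθ0K ν hν0 hν
  refine ⟨(loSum_mono ν₁ ν h1 hν K S s a).trans hlo, hhi.trans ?_⟩
  exact add_le_add (hiSum_mono L ν ν₂ h2' hν₂ θ0 K S hθ0 hθ0K s a)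
    (tailConst_mono ν ν₂ hν0 h2' hν₂ (K - 2 * S) n (by omega))

end Summit.HubbardSuperconductivity.HubbardSuperconductivity.Theorems.AnisotropyChord.Transfer.Fibre3.B1

end
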